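import Summits.CriticalPhenomena.PercolationContinuityZ3.Theorems.Transplant.FKConnectivityAllQPat3MinorDefs
import Summits.CriticalPhenomena.PercolationContinuityZ3.Theorems.Transplant.FKConnectivityAllQPat3SPGoodDefs
import HarnessLib

/-!
# Connectivity correlation inequalities for `φ_{w,q}`, every `q > 0` — THEOREM SP on MINORS: the conclusion predicate `SPGoodC` (DEFINITION)

Definitions file (`--supports stmt-CriticalPhenomena-4575`), census lineage (gen 37) of LANE 2's FK sub-programme; builds on
p205010 (kernel theorem, internal audit signed; external expert review pending).  No named facts, no sorries, nothing probabilistic.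

`FK.SPGoodC E C b s t`: THEOREM SP's conclusion for the MINOR `(E, C)` (free set `E`, contracted set `C`, the rest deleted) and
the placement `(b, s, t)`: at every level, `T_sym ≥ 0` and the three `STAR`s `≥ 0` as `FK.lev2C` values (census g36's `lev2C`).
Permutation invariance (`FK.lev2C_swap_xy/_ys`, the table identities of `…Pat3SPGoodDefs.lean`), scaling (`of_mul`), weight form
(`of_mval2C`).  Used by census g37's recursion on minors (`…Pat3MinorSteps/Recursion/AllInner/TheoremSPMinor.lean`).
[cite: AyyerLinussonRavichandran2025, §7 (p. 22)] [cite: Grimmett2006, §1.4 eq. (1.20) (p. 15)]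
-/

namespace Summit.CriticalPhenomena.PercolationContinuityZ3.Theorems

namespace FK

open SimpleGraph Literature.Probability.LatticeModels Literature.Probability.Percolation

section RelabelC

open scoped Classical

variable {V : Type*}

/-- Levelwise values on a minor under `x ↔ y`. [folklore] -/
theorem lev2C_swap_xy (E C : Finset (Sym2 V)) (x y s : V) (F : ℕ → Pat3 → Pat3 → ℤ) (μ : ℕ) :
    lev2C E C y x s F μ = lev2C E C x y s (mirror2 F) μ := by
  unfold lev2C
  refine Finset.sum_congr rfl fun γ _ => ?_
  rw [pat3_swap_xy (γ ∪ C) x y s, pat3_swap_xy (E \ γ ∪ C) x y s]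
  rfl

/-- Levelwise values on a minor under `y ↔ s`. [folklore] -/
theorem lev2C_swap_ys (E C : Finset (Sym2 V)) (x y s : V) (F : ℕ → Pat3 → Pat3 → ℤ) (μ : ℕ) :
    lev2C E C x s y F μ = lev2C E C x y s (mirror23 F) μ := by
  unfold lev2C
  refine Finset.sum_congr rfl fun γ _ => ?_
  rw [pat3_swap_ys (γ ∪ C) x y s, pat3_swap_ys (E \ γ ∪ C) x y s]
  rfl

end RelabelC

/-! ### The conclusion predicate of THEOREM SP -/

section SPGoodC

open scoped Classical

variable {V : Type*}

/-- **THEOREM SP's conclusion for one placement** (census g34, PROOF-THEOREM-SP §1.3): on the three-mark network `(E; b, s, t)`,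
at every level `μ`, `T_sym(b, s, t) ≥ 0` and `STAR(b; s, t)`, `STAR(s; b, t)`, `STAR(t; b, s) ≥ 0` — as levelwise values of the
doubled ordered tables `tsym2Tab`, `starXTab`, `mirror2 starXTab`, `starSTab`. [cite: AyyerLinussonRavichandran2025, §7 (p. 22)] -/
def SPGoodC (E C : Finset (Sym2 V)) (b s t : V) : Prop :=
  ∀ μ : ℕ, 0 ≤ lev2C E C b s t tsym2Tab μ ∧ 0 ≤ lev2C E C b s t starXTab μ ∧
    0 ≤ lev2C E C b s t (mirror2 starXTab) μ ∧ 0 ≤ lev2C E C b s t starSTab μ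

/-- Exchanging the first two marks. [folklore] -/
theorem SPGoodC.swap12 {E C : Finset (Sym2 V)} {b s t : V} (h : SPGoodC E C b s t) : SPGoodC E C s b t := by
  intro μ
  obtain ⟨h1, h2, h3, h4⟩ := h μ
  refine ⟨?_, ?_, ?_, ?_⟩
  · rw [lev2C_swap_xy, mirror2_tsym2Tab]; exact h1
  · rw [lev2C_swap_xy]; exact h3
  · rw [lev2C_swap_xy, mirror2_mirror2]; exact h2
  · rw [lev2C_swap_xy, mirror2_starSTab]; exact h4

/-- Exchanging the last two marks. [folklore] -/
theorem SPGoodC.swap23 {E C : Finset (Sym2 V)} {b s t : V} (h : SPGoodC E C b s t) : SPGoodC E C b t s := by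
  intro μ
  obtain ⟨h1, h2, h3, h4⟩ := h μ
  refine ⟨?_, ?_, ?_, ?_⟩
  · rw [lev2C_swap_ys, mirror23_tsym2Tab]; exact h1
  · rw [lev2C_swap_ys, mirror23_starXTab]; exact h2
  · rw [lev2C_swap_ys, mirror23_mirror2_starXTab]; exact h4
  · rw [lev2C_swap_ys, mirror23_starSTab]; exact h3

/-- Cyclic rotation of the marks `(b, s, t) ↦ (s, t, b)`. [folklore] -/
theorem SPGoodC.rotate {E C : Finset (Sym2 V)} {b s t : V} (h : SPGoodC E C b s t) : SPGoodC E C s t b :=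
  h.swap12.swap23

/-- Cyclic rotation of the marks `(b, s, t) ↦ (t, b, s)`. [folklore] -/
theorem SPGoodC.rotate' {E C : Finset (Sym2 V)} {b s t : V} (h : SPGoodC E C b s t) : SPGoodC E C t b s :=
  h.rotate.rotate

/-- Exchanging the first and the last mark. [folklore] -/
theorem SPGoodC.swap13 {E C : Finset (Sym2 V)} {b s t : V} (h : SPGoodC E C b s t) : SPGoodC E C t s b :=
  h.rotate.swap12

/-- `SPGoodC` is invariant under rewriting the free and contracted sets. [folklore] -/
theorem SPGoodC.congr_sets {E E' C C' : Finset (Sym2 V)} {b s t : V} (h : SPGoodC E C b s t) (hE : E = E') (hC : C = C') :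
    SPGoodC E' C' b s t :=
  hE ▸ hC ▸ h

/-- From scaled levelwise certificates `0 ≤ D · lev2` (one positive factor per table) to `SPGoodC`. [folklore] -/
theorem SPGoodC.of_mul {E C : Finset (Sym2 V)} {b s t : V} {D₁ D₂ D₃ D₄ : ℕ} (hD₁ : 0 < D₁) (hD₂ : 0 < D₂) (hD₃ : 0 < D₃)
    (hD₄ : 0 < D₄) (h₁ : ∀ μ, 0 ≤ ((D₁ : ℕ) : ℤ) * lev2C E C b s t tsym2Tab μ)
    (h₂ : ∀ μ, 0 ≤ ((D₂ : ℕ) : ℤ) * lev2C E C b s t starXTab μ)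
    (h₃ : ∀ μ, 0 ≤ ((D₃ : ℕ) : ℤ) * lev2C E C b s t (mirror2 starXTab) μ)
    (h₄ : ∀ μ, 0 ≤ ((D₄ : ℕ) : ℤ) * lev2C E C b s t starSTab μ) : SPGoodC E C b s t := by
  intro μ
  refine ⟨?_, ?_, ?_, ?_⟩
  · exact nonneg_of_mul_nonneg_right (by simpa [mul_comm] using h₁ μ) (by exact_mod_cast hD₁)
  · exact nonneg_of_mul_nonneg_right (by simpa [mul_comm] using h₂ μ) (by exact_mod_cast hD₂)
  · exact nonneg_of_mul_nonneg_right (by simpa [mul_comm] using h₃ μ) (by exact_mod_cast hD₃)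
  · exact nonneg_of_mul_nonneg_right (by simpa [mul_comm] using h₄ μ) (by exact_mod_cast hD₄)

/-- From the weight form (all four members nonnegative for every nonnegative level weight) to `SPGoodC`. [folklore] -/
theorem SPGoodC.of_mval2 {E C : Finset (Sym2 V)} {b s t : V}
    (h₁ : ∀ w : ℕ → ℝ, (∀ n, 0 ≤ w n) → 0 ≤ mval2C w E C b s t tsym2Tab)
    (h₂ : ∀ w : ℕ → ℝ, (∀ n, 0 ≤ w n) → 0 ≤ mval2C w E C b s t starXTab)
    (h₃ : ∀ w : ℕ → ℝ, (∀ n, 0 ≤ w n) → 0 ≤ mval2C w E C b s t (mirror2 starXTab))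
    (h₄ : ∀ w : ℕ → ℝ, (∀ n, 0 ≤ w n) → 0 ≤ mval2C w E C b s t starSTab) : SPGoodC E C b s t :=
  fun μ => ⟨lev2C_nonneg_of_mval2C h₁ μ, lev2C_nonneg_of_mval2C h₂ μ, lev2C_nonneg_of_mval2C h₃ μ, lev2C_nonneg_of_mval2C h₄ μ⟩

end SPGoodC

end FK

end Summit.CriticalPhenomena.PercolationContinuityZ3.Theorems
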